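import Mathlib
import Literature.Analysis.ODE.LinearComparison
import Summits.NavierStokesRegularity.NavierStokesRegularity.Theorems.SubOnsagerCeilingDyadicRangeChain
import Summits.NavierStokesRegularity.NavierStokesRegularity.Theorems.SubOnsagerCeilingDyadicRangeRegionVar
import HarnessLib

/-!
# The ν-uniform shell barrier for positive viscous Katz–Pavlović chains with NON-CONSTANT bond weights
# (helper file for crux stmt-NavierStokesRegularity-27057 `SubOnsagerCeiling.ForwardTailCeilingKP`, `--supports`;
# weighted variant of ns-soc-p2 g3's `DyadicRange.chain_shellBarrier`, on the per-bond region lemma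
# `DyadicRange.invariantRegion_le_one_of_tail_var`)

**What is proved (`chain_shellBarrier_weighted`).** Let `1 ≤ b ≤ 2`, `θ < 10`, `p := b^{5/2}/(b^θ)³ ≥ 42/25`, and let
`Z_k : [0,s] → ℝ` (`Z_{-1} ≡ 0`) be an honest solution of the WEIGHTED NS-scaled viscous chain
`Ż_k = w_{k-1} b^{5(k-1)/2} Z²_{k-1} − w_k b^{5k/2} Z_k Z_{k+1} − ν b^{2k} Z_k` (bond weights `w_k > 0`) from the one-shell datum
`Z_k(0) = x₀·1_{k=0}`, continuous, non-negative on the shells `k ≥ 1`, with Tao's weight bound.  Suppose a COMPANION SEQUENCE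
`σ_k > 0` (`σ_0 = 1`, `σ_min ≤ σ_k ≤ σ_max`) satisfies the balance relation `w_{k+1} σ_k² = w_k σ_{k+1} σ_{k+2}` (it makes the
rescaled drain coefficient constant) and the per-bond window `p²·w_k σ_{k+2}·b^θ ≤ w_{k+1} σ_{k+1}·b^{5/2}` (the rescaled bond
ratios are `≥ p²`).  Then for all `t ∈ [0,s]` and `k ≥ 0`

  `(b^θ)^{2k} Z_k(t)² ≤ (100/σ_min²)·x₀²`,

uniformly in `ν`, `s` and the datum.  Proof: ns-soc-p2's rescaling with the extra factor `σ_k`, `Y_{k+1} = A (b^θ)^k σ_k Z_k`,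
turns the weighted chain into the abstract chain `Ẏₙ = -κₙYₙ + Fₙ(Y²ₙ₋₁ − pYₙYₙ₊₁)` with `Fₙ₊₁ = wₙ b^{5n/2}/(p A (b^θ)^{n+1} σₙ₊₁)`
(the balance relation is exactly the consistency of the feed coefficient), and the per-bond region lemma gives `Y ≤ 1`.

USE.  (i) Constant weights `w ≡ c₀`, `σ ≡ 1`, `θ = 101/200`: `chain_shellBarrier` on `[17/10, 2]` again.  (ii) ALTERNATING
weights `w = (c₀, c₁, c₀, c₁, …)` — the strands of the ASYMMETRIC re-entry pair `kpTwoCycleTable c₀ c₁` — with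
`σ = (1, r, 1, r, …)`, `r = c₁/c₀`: the balance relation holds identically and the window reads `p² ≤ r^{±2}·b^{5/2−θ}`, i.e.
`|log_b(c₁/c₀)| ≤ (5θ − 5/2)/2` next to `b^{5/2−3θ} ≥ 42/25` (at `b = 2`, `θ = 0.58`: `c₁/c₀ ∈ [0.87, 1.15]`) — the first
certified corner of the asymmetric 2-cycle (uncovered in the LEAD skeleton, census v9 §G); the strand transfer to the lattice
table is NOT in this file.
HONEST FRAMING: MODEL lattice ODE statement (route SubOnsagerCeiling, rung TL-M2Break); nothing here bears on Navier–Stokes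
regularity and no stub, crux or summit is proved. [cite: BarbatoMorandinRomito2011, §2 Lemma 2.1, §3.2 proof of Thm. 1]
[cite: Tao2016AveragedNS, §4 (4.5), (4.13)]
-/

noncomputable section

-- the sub-problem namespace `NavierStokesRegularity.NavierStokesRegularity` is the tree's layout (D-0017)
set_option linter.dupNamespace false

namespace Summit.NavierStokesRegularity.NavierStokesRegularity.Theorems.DyadicRange

open Set Filter Topology

/-- The final rescaling step with a companion factor: from `0 ≤ y ≤ 1`, `y = A Bᵏ σ (s z)`, `s² = 1`, `0 < σmin ≤ σ`,
`A = (1/10)/(x + η)` one gets `B^{2k} z² ≤ (100/σmin²) (x + η)²`. [folklore] -/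
theorem unscale_bound_weighted {A B s z x η y σ σmin : ℝ} {k : ℕ} (hxη : 0 < x + η) (hA : A = 1 / 10 / (x + η))
    (hy : y = A * B ^ k * σ * (s * z)) (hs : s ^ 2 = 1) (hσmin : 0 < σmin) (hσ : σmin ≤ σ) (h0 : 0 ≤ y)
    (h1 : y ≤ 1) : B ^ (2 * k) * z ^ 2 ≤ 100 / σmin ^ 2 * (x + η) ^ 2 := by
  have hA0 : 0 < A := by rw [hA]; positivity
  have hσ0 : 0 < σ := lt_of_lt_of_le hσmin hσ
  have hsq : y ^ 2 ≤ 1 := pow_le_one₀ h0 h1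
  have hexp : y ^ 2 = (A * σ) ^ 2 * ((B ^ k) ^ 2 * z ^ 2) := by
    rw [hy]
    calc (A * B ^ k * σ * (s * z)) ^ 2 = (A * σ) ^ 2 * ((B ^ k) ^ 2 * z ^ 2) * s ^ 2 := by ring
      _ = (A * σ) ^ 2 * ((B ^ k) ^ 2 * z ^ 2) := by rw [hs, mul_one]
  rw [hexp] at hsq
  have hA2 : 0 < (A * σ) ^ 2 := by positivity
  have hmain : (B ^ k) ^ 2 * z ^ 2 ≤ 1 / (A * σ) ^ 2 := by
    rw [le_div_iff₀ hA2]; linarith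
  have hinv : 1 / (A * σ) ^ 2 = 100 * (x + η) ^ 2 / σ ^ 2 := by
    rw [hA]; field_simp; ring
  have hmono : 100 * (x + η) ^ 2 / σ ^ 2 ≤ 100 / σmin ^ 2 * (x + η) ^ 2 := by
    rw [div_le_iff₀ (by positivity : (0 : ℝ) < σ ^ 2)]
    have h3 : σmin ^ 2 ≤ σ ^ 2 := pow_le_pow_left₀ hσmin.le hσ 2
    have h4 : 0 ≤ 100 / σmin ^ 2 * (x + η) ^ 2 := by positivity
    calc 100 * (x + η) ^ 2 = 100 / σmin ^ 2 * (x + η) ^ 2 * σmin ^ 2 := by field_simp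
      _ ≤ 100 / σmin ^ 2 * (x + η) ^ 2 * σ ^ 2 := mul_le_mul_of_nonneg_left h3 h4
  rw [show B ^ (2 * k) = (B ^ k) ^ 2 by rw [mul_comm, pow_mul]]
  linarith [hmain, hinv.le, hinv.ge]

/-- **The ν-uniform shell barrier for positive viscous Katz–Pavlović chains with non-constant bond weights and a balanced
companion sequence** (see the module docstring): `(b^θ)^{2k} Z_k(t)² ≤ (100/σ_min²)·x₀²` along every honest solution on
`[0, s]` from the one-shell datum `x₀`, for every viscosity `ν > 0`. [cite: BarbatoMorandinRomito2011, §2 Lemma 2.1 and §3.2] -/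
theorem chain_shellBarrier_weighted {b θ ν s x₀ σmin σmax : ℝ} {w σc : ℕ → ℝ} (hb1 : 1 ≤ b) (hb2 : b ≤ 2)
    (hθ10 : θ < 10) (hp : 42 / 25 ≤ b ^ ((5 : ℝ) / 2) / (b ^ θ) ^ 3)
    (hw : ∀ k, 0 < w k) (hσc : ∀ k, 0 < σc k) (hσc0 : σc 0 = 1) (hσmin : 0 < σmin)
    (hσlo : ∀ k, σmin ≤ σc k) (hσhi : ∀ k, σc k ≤ σmax)
    (hbal : ∀ k, w (k + 1) * σc k ^ 2 = w k * σc (k + 1) * σc (k + 2))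
    (hwin : ∀ k, (b ^ ((5 : ℝ) / 2) / (b ^ θ) ^ 3) ^ 2 * (w k * σc (k + 2)) * b ^ θ ≤
      (w (k + 1) * σc (k + 1)) * b ^ ((5 : ℝ) / 2))
    (hν : 0 < ν) (hs : 0 < s) {Z : ℤ → ℝ → ℝ}
    (hdat : ∀ k : ℤ, Z k 0 = if k = 0 then x₀ else 0)
    (hvan : ∀ t, Z (-1) t = 0)
    (hbdd : ∃ M : ℝ, ∀ (t : ℝ) (k : ℕ), (1 + b ^ ((10 : ℝ) * k)) * |Z k t| ≤ M)
    (hcont : ∀ k : ℕ, ContinuousOn (Z k) (Icc 0 s))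
    (hode : ∀ k : ℕ, ∀ t ∈ Icc 0 s, HasDerivWithinAt (Z k)
      (w (k - 1) * b ^ ((5 : ℝ) * ((k : ℝ) - 1) / 2) * Z ((k : ℤ) - 1) t ^ 2 -
          w k * b ^ ((5 : ℝ) * (k : ℝ) / 2) * (Z k t * Z ((k : ℤ) + 1) t) -
        ν * b ^ ((2 : ℝ) * (k : ℝ)) * Z k t) (Icc 0 s) t)
    (hnn : ∀ t ∈ Icc 0 s, ∀ k : ℕ, 1 ≤ k → 0 ≤ Z k t) :
    ∀ t ∈ Icc 0 s, ∀ k : ℕ, (b ^ θ) ^ (2 * k) * Z k t ^ 2 ≤ 100 / σmin ^ 2 * x₀ ^ 2 := by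
  intro t ht k
  have hb0 : 0 < b := by linarith
  -- the constants
  set B₁ : ℝ := b ^ θ with hB₁
  set B₅ : ℝ := b ^ ((5 : ℝ) / 2) with hB₅
  have hB₁0 : 0 < B₁ := Real.rpow_pos_of_pos hb0 _
  have hB₅0 : 0 < B₅ := Real.rpow_pos_of_pos hb0 _
  set p : ℝ := B₅ / B₁ ^ 3 with hpdef
  have hp0 : 0 < p := div_pos hB₅0 (pow_pos hB₁0 3)
  have hp42 : 42 / 25 ≤ p := hp
  set c : ℝ := p⁻¹ with hc
  have hpc : p * c = 1 := mul_inv_cancel₀ hp0.ne'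
  -- powers of `b` along the shells
  have hΛ : ∀ k : ℕ, b ^ ((5 : ℝ) * (k : ℝ) / 2) = B₅ ^ k := by
    intro k
    rw [hB₅, ← Real.rpow_mul_natCast hb0.le]; congr 1; ring
  have hΛ' : ∀ k : ℕ, b ^ ((5 : ℝ) * ((k : ℝ) - 1) / 2) = B₅ ^ k / B₅ := by
    intro k
    rw [show (5 : ℝ) * ((k : ℝ) - 1) / 2 = (5 : ℝ) * (k : ℝ) / 2 - 5 / 2 by ring, Real.rpow_sub hb0,
      hΛ k]
  have h2k : ∀ k : ℕ, b ^ ((2 : ℝ) * (k : ℝ)) = (b ^ 2) ^ k := by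
    intro k
    rw [Real.rpow_mul_natCast hb0.le, Real.rpow_two]
  -- the sign of the datum shell
  set σ : ℝ := if 0 ≤ x₀ then 1 else -1 with hσ
  have hσ2 : σ ^ 2 = 1 := by rw [hσ]; split_ifs <;> norm_num
  have hσa : σ * x₀ = |x₀| := by
    rw [hσ]; split_ifs with h
    · rw [abs_of_nonneg h, one_mul]
    · rw [abs_of_neg (not_le.1 h)]; ring
  -- the datum shell keeps its sign on `[0, s]`
  have hg_nonneg : ∀ τ ∈ Icc 0 s, 0 ≤ σ * Z 0 τ := by
    have hode0 : ∀ r ∈ Ico 0 s, HasDerivWithinAt (fun r => σ * Z 0 r)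
        (0 + (-(w 0 * Z 1 r + ν)) * (σ * Z 0 r)) (Ici r) r := by
      intro r hr
      have h := hode 0 r (Ico_subset_Icc_self hr)
      have e1 : ((0 : ℕ) : ℤ) - 1 = -1 := by norm_num
      have e2 : ((0 : ℕ) : ℤ) + 1 = 1 := by norm_num
      rw [e1, e2, hvan r] at h
      have h' := (h.mono_of_mem_nhdsWithin (Icc_mem_nhdsGE_of_mem hr)).const_mul σ
      refine h'.congr_deriv ?_
      have e3 : b ^ ((5 : ℝ) * ((0 : ℕ) : ℝ) / 2) = 1 := by simp
      have e4 : b ^ ((2 : ℝ) * ((0 : ℕ) : ℝ)) = 1 := by simp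
      rw [e3, e4, Nat.zero_sub]
      ring
    have hcg : ContinuousOn (fun r => σ * Z 0 r) (Icc 0 s) := continuousOn_const.mul (hcont 0)
    have h00 : 0 ≤ σ * Z 0 0 := by rw [hdat 0, if_pos rfl, hσa]; exact abs_nonneg _
    exact datum_sign_nonneg hcg (hcont 1) hode0 h00
  -- the weight bound
  obtain ⟨M, hM⟩ := hbdd
  have hM0 : 0 ≤ M := le_trans (mul_nonneg (by positivity) (abs_nonneg _)) (hM 0 0)
  have hσmax0 : 0 < σmax := lt_of_lt_of_le (hσc 0) (hσhi 0)
  -- the bound for every `η > 0`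
  suffices main : ∀ η : ℝ, 0 < η → B₁ ^ (2 * k) * Z k t ^ 2 ≤ 100 / σmin ^ 2 * (|x₀| + η) ^ 2 by
    have hlim : Tendsto (fun η : ℝ => 100 / σmin ^ 2 * (|x₀| + η) ^ 2) (𝓝[>] 0)
        (𝓝 (100 / σmin ^ 2 * (|x₀| + 0) ^ 2)) :=
      ((tendsto_nhdsWithin_of_tendsto_nhds (f := fun η : ℝ => 100 / σmin ^ 2 * (|x₀| + η) ^ 2)
        (Continuous.tendsto (by continuity) 0)))
    rw [add_zero, sq_abs] at hlim
    exact ge_of_tendsto hlim (eventually_nhdsWithin_of_forall fun η hη => main η hη)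
  intro η hη
  have hxη : 0 < |x₀| + η := by positivity
  set A : ℝ := 1 / 10 / (|x₀| + η) with hA
  have hA0 : 0 < A := by positivity
  -- the rescaled chain
  set sg : ℕ → ℝ := fun k => if k = 0 then σ else 1 with hsg
  have hsg2 : ∀ k, sg k ^ 2 = 1 := by intro k; rw [hsg]; dsimp only; split_ifs; exact hσ2; norm_num
  set Y : ℕ → ℝ → ℝ := fun n τ =>
    if n = 0 then 0 else A * B₁ ^ (n - 1) * σc (n - 1) * (sg (n - 1) * Z ((n - 1 : ℕ) : ℤ) τ) with hY
  have hY0 : ∀ τ, Y 0 τ = 0 := fun τ => by simp [hY]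
  have hYs : ∀ (k : ℕ) (τ : ℝ), Y (k + 1) τ = A * B₁ ^ k * σc k * (sg k * Z k τ) := by
    intro k τ; simp [hY]
  have hY1 : ∀ τ, Y 1 τ = A * (σ * Z 0 τ) := fun τ => by
    rw [show (1 : ℕ) = 0 + 1 from rfl, hYs]; simp [hsg, hσc0]
  have hY2 : ∀ (j : ℕ) (τ : ℝ), Y (j + 2) τ = A * B₁ ^ (j + 1) * σc (j + 1) * Z ((j + 1 : ℕ) : ℤ) τ := by
    intro j τ; rw [show j + 2 = (j + 1) + 1 from rfl, hYs]; simp [hsg]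
  set b2 : ℝ := b ^ 2 with hb2def
  have hb20 : 0 < b2 := by rw [hb2def]; positivity
  have hb21 : 1 ≤ b2 := by rw [hb2def]; exact one_le_pow₀ hb1
  have hb24 : b2 ≤ 4 := by rw [hb2def]; nlinarith
  set κ : ℕ → ℝ := fun n => ν * b2 ^ n / b2 with hκ
  -- the production rates: drain-based definition
  set Fm : ℕ → ℝ := fun m => w m * B₅ ^ m / (p * A * B₁ ^ (m + 1) * σc (m + 1)) with hFm
  set F : ℕ → ℝ := fun n => if n = 0 then Fm 0 / p ^ 2 else Fm (n - 1) with hF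
  have hFm0 : ∀ m, 0 < Fm m := fun m => by
    simp only [hFm]
    exact div_pos (mul_pos (hw m) (pow_pos hB₅0 m)) (by
      have := hσc (m + 1); positivity)
  have hFs : ∀ k : ℕ, F (k + 1) = Fm k := fun k => by simp [hF]
  obtain ⟨hκpos, hκmono, hκ4, hκs0⟩ :
      (∀ n, 0 < κ n) ∧ (∀ n, κ n ≤ κ (n + 1)) ∧ (∀ n, κ (n + 1) ≤ 4 * κ n) ∧
        (∀ k : ℕ, κ (k + 1) = ν * b2 ^ k) := kappa_facts hν hb20 hb21 hb24
  have hκs : ∀ k : ℕ, κ (k + 1) = ν * b2 ^ k := hκs0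
  have hFpos : ∀ n, 0 < F n := by
    intro n
    rcases n with _ | m
    · simp only [hF, if_true]; exact div_pos (hFm0 0) (pow_pos hp0 2)
    · rw [hFs]; exact hFm0 m
  -- the per-bond ratios `p² Fₙ ≤ Fₙ₊₁` (the window hypothesis)
  have hFp : ∀ n, p ^ 2 * F n ≤ F (n + 1) := by
    intro n
    rcases n with _ | m
    · simp only [hF, if_true, zero_add, one_ne_zero, if_false]
      rw [mul_div_cancel₀ _ (pow_pos hp0 2).ne']
    · rw [hFs, show m + 1 + 1 = (m + 1) + 1 from rfl, hFs]
      simp only [hFm]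
      have hden1 : 0 < p * A * B₁ ^ (m + 1) * σc (m + 1) := by have := hσc (m + 1); positivity
      have hden2 : 0 < p * A * B₁ ^ (m + 1 + 1) * σc (m + 1 + 1) := by have := hσc (m + 1 + 1); positivity
      rw [← mul_div_assoc, div_le_div_iff₀ hden1 hden2]
      have hwin' := hwin m
      have hfac : 0 ≤ p * A * B₁ ^ (m + 1) * B₅ ^ m := by positivity
      have key : p ^ 2 * (w m * B₅ ^ m) * (p * A * B₁ ^ (m + 1 + 1) * σc (m + 1 + 1)) =
          (p * A * B₁ ^ (m + 1) * B₅ ^ m) * (p ^ 2 * (w m * σc (m + 2)) * B₁) := by ring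
      have key2 : w (m + 1) * B₅ ^ (m + 1) * (p * A * B₁ ^ (m + 1) * σc (m + 1)) =
          (p * A * B₁ ^ (m + 1) * B₅ ^ m) * ((w (m + 1) * σc (m + 1)) * B₅) := by ring
      rw [key, key2]
      exact mul_le_mul_of_nonneg_left hwin' hfac
  -- continuity, positivity, datum
  have hYcont : ∀ n, ContinuousOn (Y n) (Icc 0 s) := by
    intro n
    rcases n with _ | k
    · have : Y 0 = fun _ => 0 := funext hY0
      rw [this]; exact continuousOn_const
    · have : Y (k + 1) = fun τ => A * B₁ ^ k * σc k * (sg k * Z k τ) := funext (hYs k)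
      rw [this]
      exact continuousOn_const.mul (continuousOn_const.mul (hcont k))
  have hYpos : ∀ n, ∀ τ ∈ Icc 0 s, 0 ≤ Y n τ := by
    intro n τ hτ
    rcases n with _ | k
    · rw [hY0]
    rcases k with _ | j
    · rw [hY1]; exact mul_nonneg hA0.le (hg_nonneg τ hτ)
    · rw [hY2]
      have := hσc (j + 1)
      exact mul_nonneg (by positivity) (hnn τ hτ (j + 1) (by omega))
  have hYinit : ∀ n, Y n 0 ≤ 1 / 10 := by
    intro n
    rcases n with _ | k
    · rw [hY0]; norm_num
    rcases k with _ | j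
    · have hAx : A * |x₀| ≤ 1 / 10 := by
        rw [hA, div_mul_eq_mul_div, div_le_iff₀ hxη]
        linarith [abs_nonneg x₀]
      rw [hY1, hdat 0, if_pos rfl, hσa]; exact hAx
    · have hne : (((j + 1 : ℕ) : ℤ)) ≠ 0 := Int.natCast_ne_zero.mpr (Nat.succ_ne_zero j)
      rw [hY2, hdat, if_neg hne, mul_zero]; norm_num
  -- the quiescent tail (Tao's weight bound (4.5))
  have hbt : 0 < b ^ (10 : ℝ) := Real.rpow_pos_of_pos hb0 _
  set q : ℝ := B₁ / b ^ (10 : ℝ) with hq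
  have hq0 : 0 ≤ q := by rw [hq]; positivity
  have hq1 : q < 1 := by
    rw [hq, div_lt_one hbt, hB₁]
    rcases eq_or_lt_of_le hb1 with hbe | hbl
    · -- `b = 1`: all powers are `1`; then `p = 1 < 42/25` contradicts `hp`
      exfalso
      have : p = 1 := by rw [hpdef, hB₅, hB₁, ← hbe]; simp
      linarith
    · exact Real.rpow_lt_rpow_of_exponent_lt hbl hθ10
  have hZle : ∀ (k : ℕ) (τ : ℝ), (b ^ (10 : ℝ)) ^ k * |Z k τ| ≤ M := by
    intro k τ
    have h := hM τ k
    rw [Real.rpow_mul_natCast hb0.le] at h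
    have h0 : 0 ≤ |Z k τ| := abs_nonneg _
    have h1 : (1 + (b ^ (10 : ℝ)) ^ k) * |Z k τ| = |Z k τ| + (b ^ (10 : ℝ)) ^ k * |Z k τ| := by ring
    linarith
  have hYle' : ∀ (k : ℕ) (τ : ℝ), Y (k + 1) τ ≤ A * σmax * M * q ^ k := by
    intro k τ
    rw [hYs]
    have hs : |sg k| = 1 := by
      rw [hsg]; dsimp only; split_ifs
      · rw [hσ]; split_ifs <;> norm_num
      · norm_num
    have h1 : sg k * Z k τ ≤ |Z k τ| := by
      have := le_abs_self (sg k * Z k τ)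
      rwa [abs_mul, hs, one_mul] at this
    have h2 : B₁ ^ k * |Z k τ| = q ^ k * ((b ^ (10 : ℝ)) ^ k * |Z k τ|) := by
      rw [hq, div_pow]; field_simp
    have h3 : q ^ k * ((b ^ (10 : ℝ)) ^ k * |Z k τ|) ≤ q ^ k * M :=
      mul_le_mul_of_nonneg_left (hZle k τ) (pow_nonneg hq0 k)
    have hσk := hσc k
    calc A * B₁ ^ k * σc k * (sg k * Z k τ) ≤ A * B₁ ^ k * σc k * |Z k τ| :=
          mul_le_mul_of_nonneg_left h1 (by positivity)
      _ = A * σc k * (B₁ ^ k * |Z k τ|) := by ring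
      _ = A * σc k * (q ^ k * ((b ^ (10 : ℝ)) ^ k * |Z k τ|)) := by rw [h2]
      _ ≤ A * σc k * (q ^ k * M) := mul_le_mul_of_nonneg_left h3 (by positivity)
      _ ≤ A * σmax * (q ^ k * M) :=
          mul_le_mul_of_nonneg_right (mul_le_mul_of_nonneg_left (hσhi k) hA0.le) (by positivity)
      _ = A * σmax * M * q ^ k := by ring
  obtain ⟨K, hK⟩ := geometric_tail_small hq0 hq1 (show 0 ≤ A * σmax * M by positivity)
  have hYtail : ∀ n, K + 1 ≤ n → ∀ τ ∈ Icc 0 s, Y n τ ≤ 1 / 10 := by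
    intro n hn τ _
    obtain ⟨k, rfl⟩ : ∃ k, n = k + 1 := ⟨n - 1, by omega⟩
    exact (hYle' k τ).trans (hK k (by omega))
  -- the equations of motion of the rescaled chain
  have hYderiv : ∀ n, 1 ≤ n → ∀ τ ∈ Ico 0 s, HasDerivWithinAt (Y n)
      (-κ n * Y n τ + F n * (Y (n - 1) τ ^ 2 - p * Y n τ * Y (n + 1) τ)) (Ici τ) τ := by
    intro n hn τ hτ
    obtain ⟨k, rfl⟩ : ∃ k, n = k + 1 := ⟨n - 1, by omega⟩
    have h := hode k τ (Ico_subset_Icc_self hτ)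
    rw [hΛ' k, hΛ k, h2k k] at h
    have h' := (h.mono_of_mem_nhdsWithin (Icc_mem_nhdsGE_of_mem hτ)).const_mul (A * B₁ ^ k * σc k * sg k)
    have hfun : Y (k + 1) = fun r => A * B₁ ^ k * σc k * sg k * Z k r := by
      funext r; rw [hYs]; ring
    rw [hfun]
    refine h'.congr_deriv ?_
    simp only [Nat.add_sub_cancel]
    rw [hκs k, hFs k, show k + 1 + 1 = k + 2 from rfl, hY2 k]
    have ek : ((k : ℕ) : ℤ) + 1 = (((k + 1 : ℕ)) : ℤ) := by push_cast; ring
    rw [ek]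
    have hσk1 : σc (k + 1) ≠ 0 := (hσc (k + 1)).ne'
    rcases k with _ | j
    · -- the datum shell: no feed (`Z_{-1} = 0`, `Y_0 = 0`)
      have e1 : ((0 : ℕ) : ℤ) - 1 = -1 := by norm_num
      rw [e1, hvan τ, hY0]
      simp only [hFm, pow_zero, Nat.zero_sub, zero_add, pow_one, hσc0]
      field_simp
      ring
    · have e1 : (((j + 1 : ℕ)) : ℤ) - 1 = ((j : ℕ) : ℤ) := by push_cast; ring
      have es1 : sg (j + 1) = 1 := by simp [hsg]
      rw [e1, hYs j, es1]
      simp only [hFm, Nat.add_sub_cancel]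
      -- the balance relation makes the feed coefficient consistent
      have hσj : σc j ≠ 0 := (hσc j).ne'
      have hw1 : w (j + 1) = w j * σc (j + 1) * σc (j + 2) / σc j ^ 2 := by
        rw [eq_div_iff (pow_ne_zero 2 hσj)]; exact hbal j
      have esq : sg j ^ 2 = 1 := hsg2 j
      have hB₁ne : B₁ ≠ 0 := hB₁0.ne'
      have hB₅ne : B₅ ≠ 0 := hB₅0.ne'
      have hAne : A ≠ 0 := hA0.ne'
      rw [hw1, show j + 1 + 1 = j + 2 from rfl,
        show (A * B₁ ^ j * σc j * (sg j * Z ((j : ℕ) : ℤ) τ)) ^ 2 =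
          (A * B₁ ^ j * σc j * Z ((j : ℕ) : ℤ) τ) ^ 2 * sg j ^ 2 by ring, esq, mul_one, hpdef]
      field_simp
      ring
  -- the region lemma (per-bond ratios): `Y ≤ 1`
  have hYle : ∀ n, ∀ τ ∈ Icc 0 s, Y n τ ≤ 1 :=
    invariantRegion_le_one_of_tail_var hs hκpos hκmono hκ4 hFpos hFp hp42 hpc hY0 hYcont hYderiv
      hYpos hYinit hYtail
  -- conclusion at the shell `k`
  have hYk : Y (k + 1) t = A * B₁ ^ k * σc k * (sg k * Z k t) := hYs k t
  exact unscale_bound_weighted hxη hA hYk (hsg2 k) hσmin (hσlo k) (hYpos (k + 1) t ht) (hYle (k + 1) t ht)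

end Summit.NavierStokesRegularity.NavierStokesRegularity.Theorems.DyadicRange

end
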